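import Mathlib
import Summits.ValiantsHypothesis.ValiantsHypothesis.Theorems.FifoMatchingNNNotVPSupportFnBoolean
import Summits.ValiantsHypothesis.ValiantsHypothesis.Theorems.FifoMatchingNNNotVPSupportFnCircuitBookkeeping
import Literature.Computability.Complexity.FormulaComposition
import Literature.Computability.AlgebraicComplexity.ArithCircuitProofs
import HarnessLib

/-!
# Route FifoMatching — crux `NNNotVP` (stmt-ValiantsHypothesis-11615), line `division_split`:
# the Boolean shadow of a monotone arithmetic circuit over `monotoneBasis` ALONE

Registered line `Cruxes/NNNotVP/Lines/division_split.lean`; objects `σ` / `NN` / `SuppFn` /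
`freeVars` = the line's vocabulary (`Theorems/FifoMatchingNNNotVPDivisionSplitDefs.lean`).

The companion `…SupportFnBoolean` builds, for `g ∈ ℝ≥0[x]`, a circuit over `monotoneBasis ∪ {1, 0}`
computing the support function of `g`.  Here the two constant gates are removed, so that (companion
`…SupportFnCircuitLowerBound`) the core of stub A becomes a lower bound on the tree's canonical
monotone complexity `circuitSizeOver monotoneBasis` (the quantity of `razborov_alon_boppana`, of
the approximation method `MonotoneApproximation`, …):

* `exists_monotoneCircuit_eval_ne_zero_pure` — if `g(1,…,1) ≠ 0` and `g(0,…,0) = 0` (the support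
  function of `g` is not constant) then a circuit over `monotoneBasis = {∧₂, ∨₂}` ALONE, with at
  most `L₊(g) + 2·|τ|` gates, computes `x ↦ [g(1_x) ≠ 0]`.  Trick (no gate-by-gate constant
  propagation): feed the constant wires `0` / `1` of the Boolean shadow with `⋀ᵥ xᵥ` / `⋁ᵥ xᵥ`
  instead; on inputs that are neither all-ones nor all-zeros these ARE `0` / `1`; on the all-ones
  input every wire of an `{∧₂, ∨₂}`-program is `1`, on the all-zeros input every wire is `0`, and
  the hypotheses say that this is the right answer there.

Honest framing: a construction; the monotone Boolean lower bound it is meant to receive is OPEN,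
so are stubs Z / A / B2, the crux `NNNotVP` and `VP ≠ VNP` (NOT proved).  No definitions, no named
facts.
-/

noncomputable section

-- Sub = Summit single-conjunct layout: the duplicated namespace component is mandated by the tree.
set_option linter.dupNamespace false

namespace Summit.ValiantsHypothesis.ValiantsHypothesis.Theorems.FifoMatching.NNNotVP.DivisionSplit

open MvPolynomial Literature.Computability.AlgebraicComplexity
open Literature.Computability.Complexity
open Literature.Computability.Complexity.GateList
open scoped NNReal BigOperators Classical

variable {τ : Type*}

/-! ### The Boolean shadow over `{∧₂, ∨₂}` alone -/

/-- **The Boolean shadow with constants eliminated.**  If `g(1,…,1) ≠ 0` and `g(0,…,0) = 0`, a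
circuit over `monotoneBasis` with at most `L₊(g) + 2·|τ|` gates computes `x ↦ [g(1_x) ≠ 0]`.
[folklore] -/
theorem exists_monotoneCircuit_eval_ne_zero_pure [Fintype τ] (g : MvPolynomial τ ℝ≥0)
    (h1 : eval (fun _ => (1 : ℝ≥0)) g ≠ 0) (h0 : eval (fun _ => (0 : ℝ≥0)) g = 0) :
    ∃ C : Circuit τ, C.IsOver monotoneBasis ∧ C.size ≤ complexity g + 2 * Fintype.card τ ∧
      ∀ x : τ → Bool, C.eval x = decide (eval (fun v => if x v then (1 : ℝ≥0) else 0) g ≠ 0) := by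
  -- `τ` is nonempty (else the two hypotheses contradict each other)
  obtain ⟨k, hk⟩ : ∃ k, Fintype.card τ = k + 1 := by
    rcases Nat.eq_zero_or_pos (Fintype.card τ) with h | h
    · exfalso
      haveI : IsEmpty τ := Fintype.card_eq_zero_iff.1 h
      apply h1
      rw [show (fun _ : τ => (1 : ℝ≥0)) = fun _ => 0 from funext fun v => isEmptyElim v]
      exact h0
    · exact ⟨Fintype.card τ - 1, by omega⟩
  -- an enumeration of the variables and the two replacement wires `⋀ xᵥ`, `⋁ xᵥ`
  let e : Fin (k + 1) → τ := fun i => (Fintype.equivFin τ).symm (Fin.cast hk.symm i)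
  have he : Function.Surjective e := by
    intro v
    refine ⟨Fin.cast hk (Fintype.equivFin τ v), ?_⟩
    simp [e]
  let zC : Circuit τ := Circuit.bigAnd k fun i => Circuit.input (e i)
  let oC : Circuit τ := Circuit.bigOr k fun i => Circuit.input (e i)
  have hzC : ∀ x, zC.eval x = decide (∀ v, x v = true) := by
    intro x
    rw [show zC.eval x = decide (∀ i, (Circuit.input (e i)).eval x = true) from Circuit.eval_bigAnd k _ x]
    simp only [Circuit.eval_input]
    apply decide_eq_decide.2
    exact ⟨fun h v => by obtain ⟨i, rfl⟩ := he v; exact h i, fun h i => h (e i)⟩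
  have hoC : ∀ x, oC.eval x = decide (∃ v, x v = true) := by
    intro x
    rw [show oC.eval x = decide (∃ i, (Circuit.input (e i)).eval x = true) from Circuit.eval_bigOr k _ x]
    simp only [Circuit.eval_input]
    apply decide_eq_decide.2
    exact ⟨fun ⟨i, hi⟩ => ⟨e i, hi⟩, fun ⟨v, hv⟩ => by obtain ⟨i, rfl⟩ := he v; exact ⟨i, hv⟩⟩
  -- stage 1: the inputs together with the two replacement wires, over `τ ⊕ Bool`
  have hstage1 : CktSize monotoneBasis
      (fun (x : τ → Bool) (w : τ ⊕ Bool) =>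
        (Sum.elim x (Sum.elim (fun _ : Unit => zC.eval x) (fun _ : Unit => oC.eval x)))
          (Sum.map id (fun b : Bool => if b then Sum.inr () else Sum.inl ()) w))
      (0 + (k + k)) := by
    have hz : CktSize monotoneBasis (fun (x : τ → Bool) (_ : Unit) => zC.eval x) k := by
      have := cktSize_of_circuit zC
        (Circuit.isOver_bigAnd Circuit.and_two_mem_monotoneBasis k _ fun i => Circuit.isOver_input _ _)
      rwa [show zC.size = k from size_bigAnd_input k e] at this
    have ho : CktSize monotoneBasis (fun (x : τ → Bool) (_ : Unit) => oC.eval x) k := by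
      have := cktSize_of_circuit oC
        (Circuit.isOver_bigOr Circuit.or_two_mem_monotoneBasis k _ fun i => Circuit.isOver_input _ _)
      rwa [show oC.size = k from size_bigOr_input k e] at this
    exact ((CktSize.id monotoneBasis).pair (hz.pair ho)).outMap _
  -- a minimal fan-in-two arithmetic circuit for `g`
  obtain ⟨P, hP2, hPg, hPs⟩ := ArithCircuit.exists_computes_size_eq_complexity g
  -- stage 2: the Boolean shadow of `P` over the inputs `τ ⊕ Bool`, the two extra inputs playing
  -- the constants `0` (`inr false`) and `1` (`inr true`)
  let b : (τ ⊕ Bool → Bool) → MvPolynomial τ ℝ≥0 → Bool :=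
    fun y p => decide (eval (fun v => if y (.inl v) then (1 : ℝ≥0) else 0) p ≠ 0)
  let wop : ℕ → ArithCircuit.Operand ℝ≥0 τ → (τ ⊕ Bool) ⊕ ℕ := fun i u =>
    match u with
    | .var v => .inl (.inl v)
    | .const c => if c = 0 then .inl (.inr false) else .inl (.inr true)
    | .gate j => if j < i then .inr j else .inl (.inr false)
  let wco : ℕ → ℝ≥0 × ArithCircuit.Operand ℝ≥0 τ → (τ ⊕ Bool) ⊕ ℕ := fun i a =>
    if a.1 = 0 then .inl (.inr false) else wop i a.2
  let mk : ((Fin 2 → Bool) → Bool) → ((τ ⊕ Bool) ⊕ ℕ) → ((τ ⊕ Bool) ⊕ ℕ) → Gate (τ ⊕ Bool) :=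
    fun op w₁ w₂ => ⟨2, op, ![w₁, w₂]⟩
  let tg : ℕ → ArithCircuit.Gate ℝ≥0 τ → Gate (τ ⊕ Bool) := fun i G =>
    match G with
    | .sum [] => mk (GateFn.and 2).2 (.inl (.inr false)) (.inl (.inr false))
    | .sum [a] => mk (GateFn.or 2).2 (wco i a) (wco i a)
    | .sum (a :: a' :: _) => mk (GateFn.or 2).2 (wco i a) (wco i a')
    | .prod [] => mk (GateFn.and 2).2 (.inl (.inr true)) (.inl (.inr true))
    | .prod [u] => mk (GateFn.and 2).2 (wop i u) (wop i u)
    | .prod (u :: u' :: _) => mk (GateFn.and 2).2 (wop i u) (wop i u')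
  -- wires only look back
  have hwopOK : ∀ i u m, wop i u = .inr m → m < i := by
    intro i u m h
    rcases u with v | c | j
    · simp [wop] at h
    · by_cases hc : c = 0
      · simp [wop, hc] at h
      · simp [wop, hc] at h
    · by_cases hj : j < i
      · simp [wop, hj] at h; omega
      · simp [wop, hj] at h
  have hwcoOK : ∀ i a m, wco i a = .inr m → m < i := by
    intro i a m h
    by_cases ha : a.1 = 0
    · simp [wco, ha] at h
    · simp only [wco, ha, if_false] at h
      exact hwopOK i a.2 m h
  -- the shape of every translated gate: a binary AND/OR of two earlier wires
  have hshape : ∀ i G, ∃ op w₁ w₂, tg i G = mk op w₁ w₂ ∧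
      (op = (GateFn.and 2).2 ∨ op = (GateFn.or 2).2) ∧
      (∀ m, w₁ = .inr m → m < i) ∧ (∀ m, w₂ = .inr m → m < i) := by
    intro i G
    rcases G with args | args
    · rcases args with _ | ⟨a, _ | ⟨a', rest⟩⟩
      · exact ⟨_, _, _, rfl, Or.inl rfl, fun m h => by simp at h, fun m h => by simp at h⟩
      · exact ⟨_, _, _, rfl, Or.inr rfl, hwcoOK i a, hwcoOK i a⟩
      · exact ⟨_, _, _, rfl, Or.inr rfl, hwcoOK i a, hwcoOK i a'⟩
    · rcases args with _ | ⟨u, _ | ⟨u', rest⟩⟩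
      · exact ⟨_, _, _, rfl, Or.inl rfl, fun m h => by simp at h, fun m h => by simp at h⟩
      · exact ⟨_, _, _, rfl, Or.inl rfl, hwopOK i u, hwopOK i u⟩
      · exact ⟨_, _, _, rfl, Or.inl rfl, hwopOK i u, hwopOK i u'⟩
  have hmkOK : ∀ (i : ℕ) (op : (Fin 2 → Bool) → Bool) (w₁ w₂ : (τ ⊕ Bool) ⊕ ℕ),
      (∀ m, w₁ = .inr m → m < i) → (∀ m, w₂ = .inr m → m < i) → GateOK i (mk op w₁ w₂) := by
    intro i op w₁ w₂ hw₁ hw₂ a m ha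
    fin_cases a
    · exact hw₁ m (by simpa [mk] using ha)
    · exact hw₂ m (by simpa [mk] using ha)
  have htgOK : ∀ i G, GateOK i (tg i G) := by
    intro i G
    obtain ⟨op, w₁, w₂, hG, -, hw₁, hw₂⟩ := hshape i G
    rw [hG]
    exact hmkOK i op w₁ w₂ hw₁ hw₂
  have htgB : ∀ i G, (tg i G).fn ∈ monotoneBasis := by
    intro i G
    obtain ⟨op, w₁, w₂, hG, hop, -, -⟩ := hshape i G
    rw [hG]
    rcases hop with rfl | rfl
    · exact Circuit.and_two_mem_monotoneBasis
    · exact Circuit.or_two_mem_monotoneBasis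
  -- a translated gate on a constant wire list of its own colour returns that colour
  have htgConst : ∀ (c : Bool) (i : ℕ) (G : ArithCircuit.Gate ℝ≥0 τ),
      (tg i G).op (fun a => wireOf (fun _ => c) (List.replicate i c) ((tg i G).args a)) = c := by
    intro c i G
    obtain ⟨op, w₁, w₂, hG, hop, hw₁, hw₂⟩ := hshape i G
    rw [hG]
    show op (fun a => wireOf (fun _ => c) (List.replicate i c) ((![w₁, w₂] : Fin 2 → _) a)) = c
    rw [comp_vecCons_two, wireOf_const_replicate c i w₁ hw₁, wireOf_const_replicate c i w₂ hw₂]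
    rcases hop with rfl | rfl
    · rw [Circuit.and_two_apply_pair]; cases c <;> rfl
    · rw [Circuit.or_two_apply_pair]; cases c <;> rfl
  -- semantics of wires on an input assignment whose extra inputs ARE the constants
  have hb0 : ∀ y, b y 0 = false := fun y => by simp [b]
  have hwop : ∀ (y : τ ⊕ Bool → Bool), y (.inr false) = false → y (.inr true) = true →
      ∀ (vs : List (MvPolynomial τ ℝ≥0)) (i : ℕ), vs.length = i →
      ∀ u : ArithCircuit.Operand ℝ≥0 τ, wireOf y (vs.map (b y)) (wop i u) = b y (u.eval vs) := by
    intro y hyF hyT vs i hi u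
    rcases u with v | c | j
    · simp only [wop, wireOf_inl, ArithCircuit.Operand.eval, b, eval_X]
      cases y (.inl v) <;> simp
    · by_cases hc : c = 0
      · simp [wop, hc, b, ArithCircuit.Operand.eval, hyF]
      · simp [wop, hc, b, ArithCircuit.Operand.eval, hyT]
    · by_cases hj : j < i
      · simp only [wop, hj, if_true, wireOf_inr, ArithCircuit.Operand.eval_gate]
        rw [← hb0 y, List.getD_map]
      · simp only [wop, hj, if_false, wireOf_inl, ArithCircuit.Operand.eval_gate]
        rw [List.getD_eq_default _ _ (show vs.length ≤ j by omega), hb0 y, hyF]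
  have hwco : ∀ (y : τ ⊕ Bool → Bool), y (.inr false) = false → y (.inr true) = true →
      ∀ (vs : List (MvPolynomial τ ℝ≥0)) (i : ℕ), vs.length = i →
      ∀ a : ℝ≥0 × ArithCircuit.Operand ℝ≥0 τ,
        wireOf y (vs.map (b y)) (wco i a) = b y (a.1 • a.2.eval vs) := by
    intro y hyF hyT vs i hi a
    by_cases ha : a.1 = 0
    · simp [wco, ha, hb0, hyF]
    · simp only [wco, ha, if_false]
      rw [hwop y hyF hyT vs i hi a.2]
      simp only [b, smul_eval, decide_mul_ne_zero]
      simp [ha]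
  -- semantics of gates on such an assignment
  have htg : ∀ (y : τ ⊕ Bool → Bool), y (.inr false) = false → y (.inr true) = true →
      ∀ (vs : List (MvPolynomial τ ℝ≥0)) (i : ℕ), vs.length = i →
      ∀ G : ArithCircuit.Gate ℝ≥0 τ, G.fanIn ≤ 2 →
        (tg i G).op (fun a => wireOf y (vs.map (b y)) ((tg i G).args a)) = b y (G.eval vs) := by
    intro y hyF hyT vs i hi G hG
    rcases G with args | args
    · rcases args with _ | ⟨a, _ | ⟨a', _ | ⟨a'', rest⟩⟩⟩
      · simp only [tg, mk]
        rw [comp_vecCons_two, Circuit.and_two_apply_pair]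
        simp [hb0, ArithCircuit.Gate.eval, hyF]
      · simp only [tg, mk]
        rw [comp_vecCons_two, Circuit.or_two_apply_pair, hwco y hyF hyT vs i hi a]
        simp [ArithCircuit.Gate.eval, Bool.or_self]
      · simp only [tg, mk]
        rw [comp_vecCons_two, Circuit.or_two_apply_pair, hwco y hyF hyT vs i hi a,
          hwco y hyF hyT vs i hi a']
        simp only [ArithCircuit.Gate.eval, List.map_cons, List.map_nil, List.sum_cons,
          List.sum_nil, add_zero, b, map_add, decide_add_ne_zero]
      · exfalso
        simp [ArithCircuit.Gate.fanIn, ArithCircuit.Gate.args] at hG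
    · rcases args with _ | ⟨u, _ | ⟨u', _ | ⟨u'', rest⟩⟩⟩
      · simp only [tg, mk]
        rw [comp_vecCons_two, Circuit.and_two_apply_pair]
        simp [b, ArithCircuit.Gate.eval, hyT]
      · simp only [tg, mk]
        rw [comp_vecCons_two, Circuit.and_two_apply_pair, hwop y hyF hyT vs i hi u]
        simp [ArithCircuit.Gate.eval, Bool.and_self]
      · simp only [tg, mk]
        rw [comp_vecCons_two, Circuit.and_two_apply_pair, hwop y hyF hyT vs i hi u,
          hwop y hyF hyT vs i hi u']
        simp only [ArithCircuit.Gate.eval, List.map_cons, List.map_nil, List.prod_cons,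
          List.prod_nil, mul_one, b, map_mul, decide_mul_ne_zero]
      · exfalso
        simp [ArithCircuit.Gate.fanIn, ArithCircuit.Gate.args] at hG
  -- the translated program, by induction along the arithmetic circuit
  have key : ∀ gs : List (ArithCircuit.Gate ℝ≥0 τ), (∀ G ∈ gs, G.fanIn ≤ 2) →
      ∃ bs : List (Gate (τ ⊕ Bool)), bs.length = gs.length ∧ WF bs ∧
        (∀ G ∈ bs, G.fn ∈ monotoneBasis) ∧
        (∀ y : τ ⊕ Bool → Bool, y (.inr false) = false → y (.inr true) = true →
          vals bs y = (ArithCircuit.gateValues gs).map (b y)) ∧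
        (∀ c : Bool, vals bs (fun _ => c) = List.replicate bs.length c) := by
    intro gs
    induction gs using List.reverseRecOn with
    | nil =>
      intro _
      exact ⟨[], rfl, WF.nil, fun G hG => by simp at hG, fun y _ _ => by
        simp [ArithCircuit.gateValues], fun c => by simp⟩
    | append_singleton gs G ih =>
      intro hfan
      obtain ⟨bs, hlen, hwf, hover, hvals, hconst⟩ :=
        ih fun G' hG' => hfan G' (List.mem_append_left _ hG')
      have hG : G.fanIn ≤ 2 := hfan G (List.mem_append_right _ (List.mem_singleton_self G))
      refine ⟨bs ++ [tg gs.length G], by simp [hlen], ?_, ?_, fun y hyF hyT => ?_, fun c => ?_⟩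
      · exact hwf.append_singleton (hlen ▸ htgOK gs.length G)
      · intro G' hG'
        rcases List.mem_append.1 hG' with h | h
        · exact hover G' h
        · rw [List.mem_singleton] at h
          subst h
          exact htgB _ _
      · rw [vals_append_singleton, hvals y hyF hyT, ArithCircuit.gateValues_append_singleton,
          List.map_append, List.map_singleton,
          htg y hyF hyT _ gs.length (ArithCircuit.gateValues_length gs) G hG]
      · rw [vals_append_singleton, hconst c, List.length_append, List.length_singleton,
          List.replicate_succ', hlen, htgConst c gs.length G]
  obtain ⟨bs, hlen, hwf, hover, hvals, hconst⟩ := key P.gates hP2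
  -- stage 2 as a realization: its function is read off the output wire
  have hout : ∀ m, wop P.gates.length P.output = .inr m → m < bs.length := by
    intro m hm
    rw [hlen]
    exact hwopOK _ _ m hm
  have hstage2 : CktSize monotoneBasis
      (fun (y : τ ⊕ Bool → Bool) (_ : Unit) => wireOf y (vals bs y) (wop P.gates.length P.output))
      (complexity g) := by
    refine ⟨bs, fun _ => wop P.gates.length P.output, ?_, ⟨hwf, hover, fun _ m hm => hout m hm,
      fun y _ => rfl⟩⟩
    rw [hlen, ← hPs]; rfl
  -- compose and read off a circuit
  obtain ⟨C, hC1, hC2, hC3⟩ := (hstage1.comp hstage2).toCircuit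
  refine ⟨C, hC1, by omega, fun x => ?_⟩
  rw [hC3 x]
  -- the assignment of stage 2's inputs produced by stage 1
  set y : τ ⊕ Bool → Bool := fun w =>
    (Sum.elim x (Sum.elim (fun _ : Unit => zC.eval x) (fun _ : Unit => oC.eval x)))
      (Sum.map id (fun b : Bool => if b then Sum.inr () else Sum.inl ()) w) with hy
  have hyv : ∀ v, y (.inl v) = x v := fun v => rfl
  have hyF : y (.inr false) = zC.eval x := rfl
  have hyT : y (.inr true) = oC.eval x := rfl
  show wireOf y (vals bs y) (wop P.gates.length P.output) = _
  by_cases hall : ∀ v, x v = true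
  · -- all-ones input: every wire is `1`, and `g(1,…,1) ≠ 0`
    have hy1 : y = fun _ => true := by
      funext w
      rcases w with v | bb
      · exact hall v
      · cases bb
        · rw [hyF, hzC]; exact decide_eq_true hall
        · rw [hyT, hoC]; exact decide_eq_true ⟨e 0, hall _⟩
    rw [hy1, hconst true, wireOf_const_replicate true _ _ (hlen ▸ hwopOK _ _)]
    rw [show (fun v => if x v then (1 : ℝ≥0) else 0) = fun _ => 1 from
      funext fun v => by rw [hall v, if_pos rfl]]
    exact (decide_eq_true h1).symm
  by_cases hnone : ∃ v, x v = true
  · -- generic input: the two extra wires ARE the constants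
    have hyF' : y (.inr false) = false := by
      rw [hyF, hzC]; exact decide_eq_false hall
    have hyT' : y (.inr true) = true := by
      rw [hyT, hoC]; exact decide_eq_true hnone
    rw [hvals y hyF' hyT', hwop y hyF' hyT' _ P.gates.length
      (ArithCircuit.gateValues_length P.gates) P.output]
    show b y P.eval = _
    rw [show P.eval = g from hPg]
    rfl
  · -- all-zeros input: every wire is `0`, and `g(0,…,0) = 0`
    push Not at hnone
    have hy0 : y = fun _ => false := by
      funext w
      rcases w with v | bb
      · exact Bool.eq_false_iff.2 (hnone v)
      · cases bb
        · rw [hyF, hzC]; exact decide_eq_false hall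
        · rw [hyT, hoC]
          exact decide_eq_false (by push Not; exact hnone)
    rw [hy0, hconst false, wireOf_const_replicate false _ _ (hlen ▸ hwopOK _ _)]
    rw [show (fun v => if x v then (1 : ℝ≥0) else 0) = fun _ => 0 from
      funext fun v => by rw [if_neg (hnone v)]]
    rw [h0]
    simp

end Summit.ValiantsHypothesis.ValiantsHypothesis.Theorems.FifoMatching.NNNotVP.DivisionSplit

end
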